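import Summits.PneNP.PneNP.Theorems.ConvexRankGatesLinAlgGateBlindPlanting
import Summits.PneNP.PneNP.Theorems.ConvexRankGatesLinAlgGateBlindDenseRegime
import Summits.PneNP.PneNP.Theorems.ConvexRankGatesLinAlgGateBlindPermSmallDimAux
import Summits.PneNP.PneNP.Theorems.ConvexRankGatesLinAlgGateBlindVisibleRigidity

/-!
# Route ConvexRankGates, crux `LinAlgGateBlind` (stmt-PneNP-10681): SG for span programs of dimension `≤ m^{3/4-o(1)}`

Support lemma for the research stub `stub_sgPerm` (line `dnf-invariant-wide-gates-see-small-cliques`), vocabulary of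
`Theorems/ConvexRankGatesLinAlgGateBlindDefs.lean`. The lead's planting theorem `sg_of_maxtermCover`
(`Theorems/ConvexRankGatesLinAlgGateBlindPlanting.lean`) gives SG for every term gate whose rejection region is covered
by `N` all-off events with `N ≤ 2^{m^{3/4}/2}`; for a general `PERM_d` gate the maxterms are the subgroups avoiding
the target, `N ≤ #Sub(Sym(d)) = 2^{O(d² log² d)}`, whence the landed range `d ≤ m^{3/8-o(1)}`
(`sgAt_perm_of_dim_le`). For the PARITY-TYPE sub-class — (bundled) monotone span programs over a finite field `F`,
`O(x) = [t ∈ span {r a : ⌈atom a⌉(x)}]`, rows `r a ∈ F^D` (which sit inside abelian PERM gates on `D·|F|` points,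
`Cruxes/LinAlgGateBlind/Disproof.lean: spanProgram_isPermGate`) — the maxterms are far fewer: a rejected graph's
present rows span a subspace avoiding `t`, which lies in the kernel of a linear functional `φ` with `φ t = 1`
(`exists_dual_eq_one_of_notMem`), and conversely; so the rejection region is covered by the all-off events
`{all atoms of inputs a with φ (r a) ≠ 0 off}`, indexed by at most `|Dual| = |F|^D` functionals.

* `sg_spanProgram_of_cover_budget` — the finite form: positive budget `(ν·C(l,2))^t·C(m-t,k-t) ≤ ε·C(m,k)` and
  fragility budget `|F|^D · (1/2)^{ν+1} · #𝒱(l) < ε` give `#lostPos ≤ ε·C(m,k)` and `gainedNeg ≤ ε`.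
* `sg_spanProgram_of_dim_le` (registered) — at the parameters of the line: for every `c`, eventually in `m`, every
  bundled span-program term gate over a finite field `F` with `D · log₂ |F| ≤ m^{3/4}/2` is `epsOf c m`-approximated
  one-sidedly on (bare `kOf m`-cliques) × `G(m, qOf m)` by a small-clique DNF over `≤ lOf m`-atoms. For `F = 𝔽₂`
  this is the range `D ≤ m^{3/4}/2`, i.e. dimension exponent `3/4` instead of the generic `3/8`.

No new definitions. [folklore]
-/

-- `Summit.PneNP.PneNP.…` duplicates `PneNP` BY DESIGN (single-problem summit).
set_option linter.dupNamespace false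

namespace Summit.PneNP.PneNP.Theorems

open Finset Filter Literature.Computability.Complexity Razborov
open Summit.PneNP.PneNP.Cruxes.LinAlgGateBlind.DnfInvariantWideGatesSeeSmallCliques

/-- **The maxterm cover of a span-program term gate by linear functionals.** A graph is rejected iff some linear
functional normalised at the target kills the rows of all present inputs. [folklore] -/
theorem spanProgram_eq_false_iff {m : ℕ} {F V A : Type} [Field F] [AddCommGroup V] [Module F V]
    (r : A → V) (atom : A → Finset (Fin m)) (tgt : V) (O : (KEdge m → Bool) → Bool)
    (hO : ∀ x, O x = true ↔ tgt ∈ Submodule.span F (r '' {a | CliquePresent (atom a) x}))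
    (x : KEdge m → Bool) :
    O x = false ↔ ∃ φ : Module.Dual F V, φ tgt = 1 ∧ ∀ a, φ (r a) ≠ 0 → ¬ CliquePresent (atom a) x := by
  constructor
  · intro hx
    have htgt : tgt ∉ Submodule.span F (r '' {a | CliquePresent (atom a) x}) := fun h => by
      have := (hO x).2 h
      rw [hx] at this
      exact Bool.false_ne_true this
    obtain ⟨φ, h1, h2⟩ := exists_dual_eq_one_of_notMem _ htgt
    exact ⟨φ, h1, fun a hne ha => hne (h2 _ (Submodule.subset_span ⟨a, ha, rfl⟩))⟩
  · rintro ⟨φ, h1, h2⟩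
    cases hx : O x
    · rfl
    · exfalso
      have hle : Submodule.span F (r '' {a | CliquePresent (atom a) x}) ≤ LinearMap.ker φ := by
        refine Submodule.span_le.2 ?_
        rintro _ ⟨a, ha, rfl⟩
        by_contra hne
        exact h2 a hne ha
      have := LinearMap.mem_ker.1 (hle ((hO x).1 hx))
      rw [h1] at this
      exact one_ne_zero this

/-- **SG for span-program term gates with a fragility budget (finite form).** Positive budget
`(ν·C(l,2))^t · C(m-t,k-t) ≤ ε·C(m,k)` and fragility budget `|F|^D · (1/2)^{ν+1} · #𝒱(l) < ε` (with
`1 - q^{C(l,2)} ≤ 1/2`, `2t ≤ l`) give a small-clique DNF with `#lostPos ≤ ε·C(m,k)` and `gainedNeg ≤ ε` for every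
bundled span-program term gate with rows in `F^D`, `F` a finite field. [folklore] -/
theorem sg_spanProgram_of_cover_budget :
    ∀ (m l k D ν t : ℕ) (q ε : ℝ), 0 ≤ q → q ≤ 1 → 1 - q ^ (l.choose 2) ≤ 1 / 2 → 0 < ε → 2 * t ≤ l →
      (((ν * l.choose 2) ^ t * (m - t).choose (k - t) : ℕ) : ℝ) ≤ ε * (m.choose k : ℝ) →
    ∀ {F A : Type} [Field F] [Fintype F] [Fintype A],
      (Fintype.card F : ℝ) ^ D * (1 / 2) ^ (ν + 1) * #(smallSets (Fin m) l) < ε →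
    ∀ (r : A → (Fin D → F)) (atom : A → Finset (Fin m)), (∀ a, atom a ∈ smallSets (Fin m) l) →
    ∀ (tgt : Fin D → F) (O : (KEdge m → Bool) → Bool),
      (∀ x, O x = true ↔ tgt ∈ Submodule.span F (r '' {a | CliquePresent (atom a) x})) →
      ∃ 𝒜 ⊆ smallSets (Fin m) l,
        (#(lostPos m k O 𝒜) : ℝ) ≤ ε * (m.choose k : ℝ) ∧ gainedNeg m q O 𝒜 ≤ ε := by
  intro m l k D ν t q ε hq0 hq1 hql hε htl hpos F A _ _ _ hfrag r atom hatom tgt O hO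
  classical
  have hiff := spanProgram_eq_false_iff r atom tgt O hO
  -- index the cover by the functionals normalised at the target
  have hV : (0 : ℝ) < #(smallSets (Fin m) l) := Nat.cast_pos.2 (card_pos.2 ⟨∅, empty_mem_smallSets l⟩)
  haveI : Finite (Module.Dual F (Fin D → F)) :=
    Finite.of_injective (fun φ : Module.Dual F (Fin D → F) => (φ : (Fin D → F) → F)) DFunLike.coe_injective
  set J := {φ : Module.Dual F (Fin D → F) // φ tgt = 1} with hJ
  set N := Nat.card J with hNdef
  set e : J ≃ Fin N := Finite.equivFin J with he
  set 𝓛 : Fin N → Finset (Finset (Fin m)) :=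
    fun j => (univ.filter fun a => (e.symm j).1 (r a) ≠ 0).image atom with h𝓛
  have hNle : (N : ℝ) ≤ (Fintype.card F : ℝ) ^ D := by
    have h1 : N ≤ Nat.card (Module.Dual F (Fin D → F)) :=
      Nat.card_le_card_of_injective (Subtype.val : J → Module.Dual F (Fin D → F)) Subtype.val_injective
    have h2 : Nat.card (Module.Dual F (Fin D → F)) = Nat.card (Fin D → F) :=
      Nat.card_congr (Pi.basisFun F (Fin D)).toDualEquiv.toEquiv.symm
    have h3 : Nat.card (Fin D → F) = Fintype.card F ^ D := by
      rw [Nat.card_eq_fintype_card, Fintype.card_fun, Fintype.card_fin]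
    rw [h2, h3] at h1
    exact_mod_cast h1
  have hN : (N : ℝ) * (1 / 2) ^ (ν + 1) < ε / #(smallSets (Fin m) l) := by
    rw [lt_div_iff₀ hV]
    calc (N : ℝ) * (1 / 2) ^ (ν + 1) * #(smallSets (Fin m) l)
        ≤ (Fintype.card F : ℝ) ^ D * (1 / 2) ^ (ν + 1) * #(smallSets (Fin m) l) := by gcongr
      _ < ε := hfrag
  have h1 : ∀ j, 𝓛 j ⊆ smallSets (Fin m) l := by
    intro j Y hY
    obtain ⟨a, -, rfl⟩ := mem_image.1 hY
    exact hatom a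
  have h2 : ∀ x, O x = false → ∃ j, ∀ Y ∈ 𝓛 j, ¬ CliquePresent Y x := by
    intro x hx
    obtain ⟨φ, hφ, hK⟩ := (hiff x).1 hx
    refine ⟨e ⟨φ, hφ⟩, fun Y hY => ?_⟩
    obtain ⟨a, ha, rfl⟩ := mem_image.1 hY
    rw [mem_filter, Equiv.symm_apply_apply] at ha
    exact hK a ha.2
  have h3 : ∀ j x, (∀ Y ∈ 𝓛 j, ¬ CliquePresent Y x) → O x = false := fun j x hall =>
    (hiff x).2 ⟨(e.symm j).1, (e.symm j).2, fun a ha =>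
      hall (atom a) (mem_image_of_mem atom (mem_filter.2 ⟨mem_univ a, ha⟩))⟩
  obtain ⟨𝒜, h𝒜, hP, hNg⟩ := sg_of_maxtermCover m l k N ν t q (ε / #(smallSets (Fin m) l)) O 𝓛 h1 h2 h3
    hq0 hq1 hql (div_pos hε hV) hN htl
  refine ⟨𝒜, h𝒜, ?_, hNg.trans_eq (mul_div_cancel₀ ε hV.ne')⟩
  calc (#(lostPos m k O 𝒜) : ℝ) ≤ (((ν * l.choose 2) ^ t * (m - t).choose (k - t) : ℕ) : ℝ) := by
        exact_mod_cast hP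
    _ ≤ ε * (m.choose k : ℝ) := hpos

open DenseRegime in
/-- **SG for span-program term gates of dimension `D` with `D·log₂|F| ≤ m^{3/4}/2` (support lemma for
`stub_sgPerm`, stmt-PneNP-10681; the parity-type sub-range of the stub).** For every `c`, eventually in `m`: every
bundled monotone span program over a finite field `F` with rows in `F^D`, `D · log₂ |F| ≤ m^{3/4}/2`, fed with clique
atoms of `≤ lOf m` vertices, is one-sidedly `epsOf c m`-approximated on (bare `kOf m`-cliques) × `G(m, qOf m)` by a
small-clique DNF: `#lostPos ≤ epsOf c m · C(m, kOf m)` and `gainedNeg ≤ epsOf c m`. Proof: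
`sg_spanProgram_of_cover_budget` with `ν = ⌈m^{3/4}⌉₊`, `t = ⌊lOf m/2⌋`, the dense-regime facts (`stub_denseRegime`)
and the budgets `permSmallDim_budgets` of the lead's corollary, `|F|^D = 2^{D log₂ |F|} ≤ 2^{m^{3/4}/2}`. [folklore] -/
theorem sg_spanProgram_of_dim_le :
    ∀ c : ℕ, ∀ᶠ m : ℕ in atTop, ∀ (D : ℕ) {F A : Type} [Field F] [Fintype F] [Fintype A],
      (D : ℝ) * Real.logb 2 (Fintype.card F) ≤ (m : ℝ) ^ (3 / 4 : ℝ) / 2 →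
      ∀ (r : A → (Fin D → F)) (atom : A → Finset (Fin m)), (∀ a, atom a ∈ smallSets (Fin m) (lOf m)) →
      ∀ (tgt : Fin D → F) (O : (KEdge m → Bool) → Bool),
        (∀ x, O x = true ↔ tgt ∈ Submodule.span F (r '' {a | CliquePresent (atom a) x})) →
        ∃ 𝒜 ⊆ smallSets (Fin m) (lOf m),
          (#(lostPos m (kOf m) O 𝒜) : ℝ) ≤ epsOf c m * (m.choose (kOf m) : ℝ) ∧
            gainedNeg m (qOf m) O 𝒜 ≤ epsOf c m := by
  intro c
  filter_upwards [stub_denseRegime c, permSmallDim_budgets c, eventually_ge_atTop 1] with m hD hB hm D F A _ _ _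
    hdim r atom hatom tgt O hO
  obtain ⟨-, -, -, hq0, hq1, -, -, -, -, hhalf⟩ := hD
  obtain ⟨hpos, hfrag⟩ := hB
  have hmpos : (0 : ℝ) < m := by exact_mod_cast hm
  have hε : 0 < epsOf c m := by
    rw [epsOf_eq]
    positivity
  have hcardpos : (0 : ℝ) < Fintype.card F := Nat.cast_pos.2 Fintype.card_pos
  have hcard : (Fintype.card F : ℝ) ^ D ≤ (2 : ℝ) ^ ((m : ℝ) ^ (3 / 4 : ℝ) / 2) := by
    have : (Fintype.card F : ℝ) ^ D = (2 : ℝ) ^ ((D : ℝ) * Real.logb 2 (Fintype.card F)) := by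
      rw [mul_comm, Real.rpow_mul (by norm_num : (0 : ℝ) ≤ 2), Real.rpow_logb two_pos (by norm_num) hcardpos,
        Real.rpow_natCast]
    rw [this]
    exact Real.rpow_le_rpow_of_exponent_le one_le_two hdim
  refine sg_spanProgram_of_cover_budget m (lOf m) (kOf m) D ⌈(m : ℝ) ^ (3 / 4 : ℝ)⌉₊ (lOf m / 2)
    (qOf m) (epsOf c m) hq0 hq1 (by linarith) hε (Nat.mul_div_le (lOf m) 2) hpos ?_ r atom hatom tgt O hO
  calc (Fintype.card F : ℝ) ^ D * (1 / 2) ^ (⌈(m : ℝ) ^ (3 / 4 : ℝ)⌉₊ + 1) * #(smallSets (Fin m) (lOf m))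
      ≤ (2 : ℝ) ^ ((m : ℝ) ^ (3 / 4 : ℝ) / 2) * (1 / 2) ^ (⌈(m : ℝ) ^ (3 / 4 : ℝ)⌉₊ + 1) *
        #(smallSets (Fin m) (lOf m)) := by gcongr
    _ < epsOf c m := hfrag


open DenseRegime in
/-- **`SGAt` for the class of span programs over `𝔽_p` of dimension `D`, `D·log₂ p ≤ m^{3/4}/2` (the statement of
`sg_spanProgram_of_dim_le` in the exact shape of the line's single-gate statement).** The class is written inline:
gates `g` with rows `r : Fin g.1 → 𝔽_p^D` and a target `t`, `g.2 v ↔ t ∈ span {r i : v i}` — by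
`Cruxes/LinAlgGateBlind/Disproof.lean: spanProgram_isPermGate` every such gate is ONE PERM gate on `D·p` points, so
this is the parity-type (abelian, exponent `p`) sub-range of `stub_sgPerm`: for every `c`, eventually in `m`, for all
primes `p` and all `D` with `D · log₂ p ≤ m^{3/4}/2`,
`SGAt m (span programs over 𝔽_p of dimension D) (lOf m) (kOf m) (qOf m) (epsOf c m)`. [folklore] -/
theorem sgAt_spanGate_of_dim_le :
    ∀ c : ℕ, ∀ᶠ m : ℕ in atTop, ∀ (p D : ℕ), p.Prime → (D : ℝ) * Real.logb 2 p ≤ (m : ℝ) ^ (3 / 4 : ℝ) / 2 →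
      SGAt m (fun g => ∃ (r : Fin g.1 → Fin D → ZMod p) (t : Fin D → ZMod p),
          ∀ v, g.2 v = true ↔ t ∈ Submodule.span (ZMod p) (r '' {i | v i = true}))
        (lOf m) (kOf m) (qOf m) (epsOf c m) := by
  intro c
  filter_upwards [sg_spanProgram_of_dim_le c] with m hm p D hp hdim O hO
  obtain ⟨g, ⟨r, t, hg⟩, X, hX, hOX⟩ := hO
  haveI : Fact p.Prime := ⟨hp⟩
  have hcard : (D : ℝ) * Real.logb 2 (Fintype.card (ZMod p)) ≤ (m : ℝ) ^ (3 / 4 : ℝ) / 2 := by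
    rwa [ZMod.card]
  refine hm D hcard r X hX t O fun x => ?_
  rw [hOX x, hg]
  have hset : {i | (fun a => atomB (X a) x) i = true} = {a | CliquePresent (X a) x} := by
    ext a
    simp [atomB]
  rw [hset]

end Summit.PneNP.PneNP.Theorems
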